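import Mathlib.Analysis.InnerProductSpace.Projection.Basic
import Mathlib.Analysis.InnerProductSpace.PiL2
import Mathlib.Topology.MetricSpace.Sequences
import HarnessLib

/-!
# Linearly independent limits of almost-orthogonally-split subspaces (a Hilbert-space lemma for the semicontinuity of Hodge numbers)

Topic `Literature/Analysis/OperatorTheory`. An elementary lemma on inner product spaces which is
the functional-analytic skeleton of the upper semicontinuity of the Hodge numbers `h^{p,q}(X_s)` in
a family of compact KÄHLER manifolds (C. Voisin, *Hodge Theory and Complex Algebraic Geometry I*
(2002), §9.3.1 Thm. 9.15 / Cor. 9.19, there deduced from K. Kodaira's theorem on `C^∞` families of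
strongly elliptic operators, *Complex Manifolds and Deformation of Complex Structures* (2005),
Thm. 7.3: "`dim 𝔽_t` is upper semicontinuous"), in the form in which the tree proves it for
projective families (`AlgebraicGeometry/Motives/FiberNetExistenceProofs`): after transporting the
harmonic `(p,q)`-forms of the fibre `X_{s_i}` to the central fibre `X₀` one obtains subspaces `W_i`
of the pre-Hilbert space `V = A^k(X₀; ℂ)` of smooth `k`-forms (with the `L²` product of the Kähler
metric of `X₀`) such that

* every `w ∈ W_i` is closed, hence splits as `w = h + dβ` with `h` harmonic and `dβ` exact
  (Hodge theorem on `X₀`): `W_i ≤ H ⊔ D` with `H` (harmonic forms) FINITE-DIMENSIONAL and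
  orthogonal to `D` (exact forms);
* every `w ∈ W_i` is coclosed for the transported metric `g_i`: `B_i(dβ, w) = 0` for the
  transported `L²` product `B_i`, which is close to that of `X₀`:
  `|B_i(a, b) - ⟪a, b⟫| ≤ ε_i (‖a‖² + ‖b‖²)`, `ε_i → 0`;
* every `w ∈ W_i` is of type `(p,q)` for the transported complex structure: `L_i w = w` for type
  projectors `L_i` converging to the type projector `L` of `X₀`: `‖L_i w - L w‖ ≤ η_i ‖w‖`, `η_i → 0`.

The conclusion — if each `W_i` contains `N` linearly independent vectors then `H` contains `N`
linearly independent vectors FIXED by `L` (harmonic `(p,q)`-forms on `X₀`) — is proved here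
abstractly (`exists_linearIndependent_of_subspaces`), by the SOFT ESTIMATE
`‖w - P w‖² = ⟪w - P w, w⟫ = ⟪w - Pw, w⟫ - B_i(w - Pw, w) ≤ ε_i (‖w - Pw‖² + ‖w‖²)` for the
orthogonal projection `P` onto `H` (`norm_sub_starProjection_sq_le`: no derivative of `w` is ever
estimated — the compactness that Kodaira's proof draws from uniform Gårding inequalities and
Rellich's lemma comes here from `dim H < ∞` alone), orthonormalisation of the projected frames
inside `H`, Bolzano–Weierstrass in `H^N`, and passage to the limit in `L_i w = w`.

Everything is proved; no definitions, no named facts (D-0026). Scalars: any `RCLike` field.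

## References

* C. Voisin, *Hodge Theory and Complex Algebraic Geometry I*, CUP (2002), §9.3.1 Thm. 9.15,
  Prop. 9.17 (Kodaira), Cor. 9.19; §9.3.2 Prop. 9.20. [VoisinHodgeI2002]
* K. Kodaira, *Complex Manifolds and Deformation of Complex Structures*, Springer Classics (2005),
  §7.2 Thm. 7.3, Thm. 7.8. [Kodaira2005]
-/

noncomputable section

open Filter Topology Submodule

namespace Literature.Analysis.OperatorTheory

variable {𝕜 : Type*} [RCLike 𝕜] {V : Type*} [NormedAddCommGroup V] [InnerProductSpace 𝕜 V]

/-! ### The soft estimate -/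

/-- **Orthogonal projection onto `H` along an orthogonal (not necessarily closed, not necessarily
complementary) subspace `D`**: if `w = h + d` with `h ∈ H`, `d ∈ D` and `H ⊥ D`, then the
orthogonal projection of `w` onto `H` is `h`, i.e. `w - P w = d ∈ D`. [folklore] -/
theorem sub_starProjection_mem_of_mem_sup (H D : Submodule 𝕜 V) [H.HasOrthogonalProjection]
    (hHD : ∀ h ∈ H, ∀ d ∈ D, inner 𝕜 h d = 0) {w : V} (hw : w ∈ H ⊔ D) :
    w - H.starProjection w ∈ D := by
  obtain ⟨h, hh, d, hd, rfl⟩ := Submodule.mem_sup.1 hw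
  have hP : H.starProjection (h + d) = h := by
    refine eq_starProjection_of_mem_of_inner_eq_zero hh fun x hx ↦ ?_
    rw [add_sub_cancel_left, inner_eq_zero_symm]
    exact hHD x hx d hd
  rw [hP, add_sub_cancel_left]
  exact hd

/-- **The soft estimate.** Let `H ⊥ D` be subspaces of an inner product space, `H` admitting an
orthogonal projection `P`, and `w ∈ H ⊔ D`. If a form `B` kills `(d, w)` for all `d ∈ D`
("`w` is `B`-coclosed") and is `ε`-close to the inner product on such pairs,
`‖B(d, w) - ⟪d, w⟫‖ ≤ ε (‖d‖² + ‖w‖²)`, then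
`‖w - P w‖² ≤ ε (‖w - P w‖² + ‖w‖²)`: indeed `d := w - P w ∈ D`, `P w ⊥ d`, so
`‖d‖² = ⟪d, w⟫ = ⟪d, w⟫ - B(d, w)`. [folklore] -/
theorem norm_sub_starProjection_sq_le (H D : Submodule 𝕜 V) [H.HasOrthogonalProjection]
    (hHD : ∀ h ∈ H, ∀ d ∈ D, inner 𝕜 h d = 0) {w : V} (hw : w ∈ H ⊔ D) {B : V → V → 𝕜} {ε : ℝ}
    (hB0 : ∀ d ∈ D, B d w = 0)
    (hBε : ∀ d ∈ D, ‖B d w - inner 𝕜 d w‖ ≤ ε * (‖d‖ ^ 2 + ‖w‖ ^ 2)) :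
    ‖w - H.starProjection w‖ ^ 2 ≤ ε * (‖w - H.starProjection w‖ ^ 2 + ‖w‖ ^ 2) := by
  set d := w - H.starProjection w with hd_def
  have hd : d ∈ D := sub_starProjection_mem_of_mem_sup H D hHD hw
  -- `⟪d, d⟫ = ⟪d, w⟫`: `P w ∈ H` is orthogonal to `d ∈ D`
  have h1 : inner 𝕜 d d = inner 𝕜 d w := by
    have : inner 𝕜 d ((H.starProjection w : V)) = 0 := by
      rw [inner_eq_zero_symm]
      exact hHD _ (starProjection_apply_mem H w) d hd
    rw [hd_def, inner_sub_right, this, sub_zero]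
  have h2 : (‖d‖ ^ 2 : ℝ) = RCLike.re (inner 𝕜 d w - B d w) := by
    rw [hB0 d hd, sub_zero, ← h1]
    exact norm_sq_eq_re_inner (𝕜 := 𝕜) d
  calc ‖d‖ ^ 2 = RCLike.re (inner 𝕜 d w - B d w) := h2
    _ ≤ ‖inner 𝕜 d w - B d w‖ := RCLike.re_le_norm _
    _ = ‖B d w - inner 𝕜 d w‖ := norm_sub_rev _ _
    _ ≤ ε * (‖d‖ ^ 2 + ‖w‖ ^ 2) := hBε d hd

/-- Consequence of the soft estimate for `|ε| ≤ 1/8`: `‖w - P w‖² ≤ 2|ε| ‖w‖²` and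
`‖w‖ ≤ 2 ‖P w‖` (absorption). [folklore] -/
theorem norm_sub_starProjection_sq_le_of_abs_le (H D : Submodule 𝕜 V) [H.HasOrthogonalProjection]
    (hHD : ∀ h ∈ H, ∀ d ∈ D, inner 𝕜 h d = 0) {w : V} (hw : w ∈ H ⊔ D) {B : V → V → 𝕜} {ε : ℝ}
    (hε : |ε| ≤ 1 / 8) (hB0 : ∀ d ∈ D, B d w = 0)
    (hBε : ∀ d ∈ D, ‖B d w - inner 𝕜 d w‖ ≤ ε * (‖d‖ ^ 2 + ‖w‖ ^ 2)) :
    ‖w - H.starProjection w‖ ^ 2 ≤ 2 * |ε| * ‖w‖ ^ 2 ∧ ‖w‖ ≤ 2 * ‖H.starProjection w‖ := by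
  have key := norm_sub_starProjection_sq_le H D hHD hw hB0 hBε
  set x := ‖w - H.starProjection w‖ with hx
  have hx0 : 0 ≤ x := norm_nonneg _
  have hw0 : 0 ≤ ‖w‖ := norm_nonneg _
  have key' : x ^ 2 ≤ |ε| * (x ^ 2 + ‖w‖ ^ 2) :=
    key.trans (mul_le_mul_of_nonneg_right (le_abs_self ε) (by positivity))
  have h1 : x ^ 2 ≤ 2 * |ε| * ‖w‖ ^ 2 := by
    -- `(1 - |ε|) x² ≤ |ε| ‖w‖²` and `1 - |ε| ≥ 1/2`
    have hε0 : 0 ≤ |ε| := abs_nonneg ε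
    nlinarith [sq_nonneg x, sq_nonneg ‖w‖, mul_nonneg hε0 (sq_nonneg ‖w‖)]
  refine ⟨h1, ?_⟩
  -- `x ≤ ‖w‖ / 2`, then `‖w‖ ≤ ‖P w‖ + x`
  have h2 : x ^ 2 ≤ (‖w‖ / 2) ^ 2 := by
    have : 2 * |ε| * ‖w‖ ^ 2 ≤ (1 / 4) * ‖w‖ ^ 2 := by
      have : 2 * |ε| ≤ 1 / 4 := by linarith
      exact mul_le_mul_of_nonneg_right this (sq_nonneg _)
    calc x ^ 2 ≤ 2 * |ε| * ‖w‖ ^ 2 := h1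
      _ ≤ (1 / 4) * ‖w‖ ^ 2 := this
      _ = (‖w‖ / 2) ^ 2 := by ring
  have h3 : x ≤ ‖w‖ / 2 := (sq_le_sq₀ hx0 (by positivity)).1 h2
  have h4 : ‖w‖ ≤ ‖H.starProjection w‖ + x := by
    have := norm_add_le (H.starProjection w) (w - H.starProjection w)
    rwa [add_sub_cancel] at this
  linarith

/-! ### The limit lemma -/

section Limit

variable (H D : Submodule 𝕜 V) [FiniteDimensional 𝕜 H]

omit [FiniteDimensional 𝕜 H] in
/-- From the soft estimate: if `u ∈ H ⊔ D` is `B`-coclosed with `B` `ε`-close to the inner product,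
`|ε| ≤ 1/8`, and its projection `P u` is a unit vector, then `‖u‖ ≤ 2` and
`‖u - P u‖ ≤ 2 √(2|ε|)`. [folklore] -/
theorem norm_sub_starProjection_le_of_norm_eq_one [H.HasOrthogonalProjection]
    (hHD : ∀ h ∈ H, ∀ d ∈ D, inner 𝕜 h d = 0) {u : V} (hu : u ∈ H ⊔ D) {B : V → V → 𝕜} {ε : ℝ}
    (hε : |ε| ≤ 1 / 8) (hB0 : ∀ d ∈ D, B d u = 0)
    (hBε : ∀ d ∈ D, ‖B d u - inner 𝕜 d u‖ ≤ ε * (‖d‖ ^ 2 + ‖u‖ ^ 2))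
    (h1 : ‖H.starProjection u‖ = 1) :
    ‖u‖ ≤ 2 ∧ ‖u - H.starProjection u‖ ≤ 2 * Real.sqrt (2 * |ε|) := by
  obtain ⟨hsq, hle⟩ := norm_sub_starProjection_sq_le_of_abs_le H D hHD hu hε hB0 hBε
  rw [h1, mul_one] at hle
  refine ⟨hle, ?_⟩
  have hε0 : 0 ≤ 2 * |ε| := by positivity
  have : ‖u - H.starProjection u‖ ^ 2 ≤ (2 * Real.sqrt (2 * |ε|)) ^ 2 := by
    calc ‖u - H.starProjection u‖ ^ 2 ≤ 2 * |ε| * ‖u‖ ^ 2 := hsq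
      _ ≤ 2 * |ε| * 2 ^ 2 := by
          exact mul_le_mul_of_nonneg_left (pow_le_pow_left₀ (norm_nonneg _) hle 2) hε0
      _ = (2 * Real.sqrt (2 * |ε|)) ^ 2 := by
          rw [mul_pow, Real.sq_sqrt hε0]; ring
  exact (sq_le_sq₀ (norm_nonneg _) (by positivity)).1 this

/-- **Linearly independent `L`-fixed limits in `H`.** Let `V` be an inner product space,
`H ≤ V` a finite-dimensional subspace orthogonal to a subspace `D`, `L : V → V` a bounded
operator, and for `i ∈ ℕ` let `W_i ≤ H ⊔ D` be subspaces, `B_i : V → V → 𝕜` forms and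
`L_i : V → V` maps such that, for all `w ∈ W_i` and `d ∈ D`: `B_i(d, w) = 0`,
`‖B_i(d, w) - ⟪d, w⟫‖ ≤ ε_i (‖d‖² + ‖w‖²)`, `L_i w = w`, `‖L_i w - L w‖ ≤ η_i ‖w‖`, with
`ε_i → 0`, `η_i → 0`. If every `W_i` contains `N` linearly independent vectors, then `H` contains
`N` linearly independent vectors `h` with `L h = h`. Proof: for `|ε_i| ≤ 1/8` the orthogonal
projection `P : V → H` is injective on `W_i` with `‖w‖ ≤ 2‖P w‖` (soft estimate,
`norm_sub_starProjection_sq_le`); orthonormalise the projected frame inside `H` and lift it back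
to `u_i^j ∈ W_i` with `P u_i^j = b_i^j` orthonormal, so that `‖u_i^j - b_i^j‖ ≤ 2√(2|ε_i|)`; by
Bolzano–Weierstrass in `H^N` a subsequence of `(b_i^j)_j` converges to an orthonormal frame
`(b^j)` of `H`, and `‖L b^j - b^j‖ ≤ ‖L‖ ‖b^j - b_i^j‖ + (‖L‖ + 1) ‖b_i^j - u_i^j‖ + 2|η_i| +
‖b_i^j - b^j‖ → 0` along it (using `L_i u_i^j = u_i^j`). This is the abstract form of the upper
semicontinuity of `dim ker` in Kodaira's Thm. 7.3 as it is used for Kähler fibres (Voisin I,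
Cor. 9.19). [folklore] -/
theorem exists_linearIndependent_of_subspaces
    (hHD : ∀ h ∈ H, ∀ d ∈ D, inner 𝕜 h d = 0) (L : V →L[𝕜] V)
    (W : ℕ → Submodule 𝕜 V) (B : ℕ → V → V → 𝕜) (Lᵢ : ℕ → V → V) (ε η : ℕ → ℝ)
    (hε : Tendsto ε atTop (𝓝 0)) (hη : Tendsto η atTop (𝓝 0))
    (hW : ∀ i, W i ≤ H ⊔ D)
    (hB0 : ∀ i, ∀ w ∈ W i, ∀ d ∈ D, B i d w = 0)
    (hBε : ∀ i, ∀ w ∈ W i, ∀ d ∈ D, ‖B i d w - inner 𝕜 d w‖ ≤ ε i * (‖d‖ ^ 2 + ‖w‖ ^ 2))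
    (hLfix : ∀ i, ∀ w ∈ W i, Lᵢ i w = w)
    (hLη : ∀ i, ∀ w ∈ W i, ‖Lᵢ i w - L w‖ ≤ η i * ‖w‖)
    {N : ℕ} (hN : ∀ i, ∃ f : Fin N → V, LinearIndependent 𝕜 f ∧ ∀ j, f j ∈ W i) :
    ∃ f : Fin N → V, LinearIndependent 𝕜 f ∧ ∀ j, f j ∈ H ∧ L (f j) = f j := by
  classical
  /- Step 0: discard finitely many indices so that `|ε i| ≤ 1/8` for all `i`. All hypotheses are
  pointwise in `i`, so we may replace `i` by `i + i₀`. -/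
  obtain ⟨i₀, hi₀⟩ : ∃ i₀, ∀ i ≥ i₀, |ε i| ≤ 1 / 8 := by
    have : ∀ᶠ i in atTop, |ε i| ≤ 1 / 8 := by
      have h : Tendsto (fun i ↦ |ε i|) atTop (𝓝 0) := by simpa using hε.abs
      exact h.eventually (ge_mem_nhds (by norm_num))
    exact eventually_atTop.1 this
  have hε8 : ∀ i, |ε (i + i₀)| ≤ 1 / 8 := fun i ↦ hi₀ _ (Nat.le_add_left _ _)
  haveI : CompleteSpace H := FiniteDimensional.complete 𝕜 H
  set P : V →L[𝕜] V := H.starProjection with hP_def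
  /- Step 1: on `W (i + i₀)` the projection `P` is injective (`‖w‖ ≤ 2 ‖P w‖`). -/
  have est : ∀ i, ∀ w ∈ W (i + i₀), ‖w‖ ≤ 2 * ‖P w‖ := fun i w hw ↦
    (norm_sub_starProjection_sq_le_of_abs_le H D hHD (hW _ hw) (hε8 i)
      (fun d hd ↦ hB0 _ w hw d hd) (fun d hd ↦ hBε _ w hw d hd)).2
  choose f hf hfW using hN
  have hspanW : ∀ i, span 𝕜 (Set.range (f i)) ≤ W i := fun i ↦
    span_le.2 (Set.range_subset_iff.2 (hfW i))
  have hPinj : ∀ i, Disjoint (span 𝕜 (Set.range (f (i + i₀))))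
      (LinearMap.ker (P : V →ₗ[𝕜] V)) := by
    intro i
    rw [Submodule.disjoint_def]
    intro w hw hker
    have h0 : P w = 0 := hker
    have := est i w (hspanW _ hw)
    rw [h0, norm_zero, mul_zero] at this
    exact norm_le_zero_iff.1 this
  /- Step 2: the projected frame spans an `N`-dimensional subspace `S i ≤ H`, every element of
  which is `P u` for some `u ∈ W (i + i₀)`. -/
  have hPf : ∀ i, LinearIndependent 𝕜 ((P : V →ₗ[𝕜] V) ∘ f (i + i₀)) := fun i ↦
    (hf _).map (hPinj i)
  let S : ℕ → Submodule 𝕜 V := fun i ↦ span 𝕜 (Set.range ((P : V →ₗ[𝕜] V) ∘ f (i + i₀)))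
  have hS_def : ∀ i, S i = span 𝕜 (Set.range ((P : V →ₗ[𝕜] V) ∘ f (i + i₀))) := fun i ↦ rfl
  have hSN : ∀ i, Module.finrank 𝕜 (S i) = N := fun i ↦ by
    rw [hS_def, finrank_span_eq_card (hPf i), Fintype.card_fin]
  have hSH : ∀ i, S i ≤ H := fun i ↦ span_le.2 (by
    rintro _ ⟨j, rfl⟩
    exact starProjection_apply_mem H _)
  have hSP : ∀ i, ∀ v ∈ S i, ∃ u ∈ W (i + i₀), P u = v := by
    intro i v hv
    have hS : S i = (span 𝕜 (Set.range (f (i + i₀)))).map (P : V →ₗ[𝕜] V) := by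
      rw [hS_def, Set.range_comp, Submodule.span_image]
    rw [hS, Submodule.mem_map] at hv
    obtain ⟨u, hu, rfl⟩ := hv
    exact ⟨u, hspanW _ hu, rfl⟩
  /- Step 3: an orthonormal basis `b i` of `S i` and lifts `u i j ∈ W (i + i₀)`. -/
  haveI hSfin : ∀ i, FiniteDimensional 𝕜 (S i) := fun i ↦
    FiniteDimensional.span_of_finite 𝕜 (Set.finite_range _)
  let ob : ∀ i, OrthonormalBasis (Fin N) 𝕜 (S i) := fun i ↦
    (stdOrthonormalBasis 𝕜 (S i)).reindex (finCongr (hSN i))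
  let b : ℕ → Fin N → V := fun i j ↦ ((ob i j : S i) : V)
  have hb_on : ∀ i, Orthonormal 𝕜 (b i) := fun i ↦
    ((S i).subtypeₗᵢ.orthonormal_comp_iff).2 (ob i).orthonormal
  have hbS : ∀ i j, b i j ∈ S i := fun i j ↦ (ob i j).2
  have hbH : ∀ i j, b i j ∈ H := fun i j ↦ hSH i (hbS i j)
  have hb1 : ∀ i j, ‖b i j‖ = 1 := fun i j ↦ (hb_on i).norm_eq_one j
  choose u huW hPu using fun i j ↦ hSP i (b i j) (hbS i j)
  -- the lifts are close to the frame: `‖u i j‖ ≤ 2`, `‖u i j - b i j‖ ≤ 2 √(2 |ε (i + i₀)|)`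
  have hu_est : ∀ i j, ‖u i j‖ ≤ 2 ∧ ‖u i j - b i j‖ ≤ 2 * Real.sqrt (2 * |ε (i + i₀)|) := by
    intro i j
    have h := norm_sub_starProjection_le_of_norm_eq_one H D hHD (hW _ (huW i j)) (hε8 i)
      (fun d hd ↦ hB0 _ _ (huW i j) d hd) (fun d hd ↦ hBε _ _ (huW i j) d hd)
      (by rw [← hP_def, hPu i j, hb1 i j])
    rwa [← hP_def, hPu i j] at h
  /- Step 4: Bolzano–Weierstrass in `H^N`. -/
  haveI : ProperSpace H := FiniteDimensional.proper_rclike 𝕜 H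
  let c : ℕ → Fin N → H := fun i j ↦ ⟨b i j, hbH i j⟩
  have hc_bdd : ∀ i, c i ∈ Metric.closedBall (0 : Fin N → H) 1 := by
    intro i
    rw [Metric.mem_closedBall, dist_zero_right, pi_norm_le_iff_of_nonneg zero_le_one]
    intro j
    change ‖(⟨b i j, hbH i j⟩ : H)‖ ≤ 1
    rw [Submodule.coe_norm]
    exact (hb1 i j).le
  obtain ⟨a, -, φ, hφ, hlim⟩ := tendsto_subseq_of_bounded Metric.isBounded_closedBall hc_bdd
  -- the limit frame in `V`
  let g : Fin N → V := fun j ↦ (a j : V)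
  have hg_lim : ∀ j, Tendsto (fun i ↦ b (φ i) j) atTop (𝓝 (g j)) := by
    intro j
    have h1 : Tendsto (fun i ↦ c (φ i) j) atTop (𝓝 (a j)) := (tendsto_pi_nhds.1 hlim) j
    exact (continuous_subtype_val.tendsto _).comp h1
  /- Step 5: the limit frame is orthonormal, hence linearly independent. -/
  have hg_on : Orthonormal 𝕜 g := by
    rw [orthonormal_iff_ite]
    intro j j'
    have h1 : Tendsto (fun i ↦ inner 𝕜 (b (φ i) j) (b (φ i) j')) atTop (𝓝 (inner 𝕜 (g j) (g j'))) :=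
      (hg_lim j).inner (hg_lim j')
    have h2 : (fun i ↦ inner 𝕜 (b (φ i) j) (b (φ i) j')) = fun _ ↦ if j = j' then (1 : 𝕜) else 0 := by
      funext i
      exact (orthonormal_iff_ite.1 (hb_on (φ i))) j j'
    rw [h2] at h1
    exact tendsto_nhds_unique h1 tendsto_const_nhds
  refine ⟨g, hg_on.linearIndependent, fun j ↦ ⟨(a j).2, ?_⟩⟩
  /- Step 6: `L g j = g j`, by passing to the limit in `Lᵢ u = u`. -/
  -- the error terms
  set t : ℕ → ℝ := fun i ↦ 2 * Real.sqrt (2 * |ε (φ i + i₀)|) with ht_def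
  set R : ℕ → ℝ := fun i ↦
    ‖L‖ * ‖g j - b (φ i) j‖ + ‖L‖ * t i + |η (φ i + i₀)| * 2 + t i + ‖g j - b (φ i) j‖ with hR_def
  have hbound : ∀ i, ‖L (g j) - g j‖ ≤ R i := by
    intro i
    set x := g j
    set bb := b (φ i) j
    set uu := u (φ i) j
    have hfix : Lᵢ (φ i + i₀) uu = uu := hLfix _ _ (huW _ _)
    have hdecomp : L x - x =
        L (x - bb) + L (bb - uu) + (L uu - Lᵢ (φ i + i₀) uu) + (uu - bb) + (bb - x) := by
      rw [hfix, map_sub, map_sub]; abel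
    obtain ⟨hu2, hub⟩ := hu_est (φ i) j
    have e1 : ‖L (x - bb)‖ ≤ ‖L‖ * ‖x - bb‖ := L.le_opNorm _
    have e2 : ‖L (bb - uu)‖ ≤ ‖L‖ * t i :=
      (L.le_opNorm _).trans (mul_le_mul_of_nonneg_left (by rwa [norm_sub_rev]) (norm_nonneg _))
    have e3 : ‖L uu - Lᵢ (φ i + i₀) uu‖ ≤ |η (φ i + i₀)| * 2 := by
      rw [norm_sub_rev]
      calc ‖Lᵢ (φ i + i₀) uu - L uu‖ ≤ η (φ i + i₀) * ‖uu‖ := hLη _ _ (huW _ _)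
        _ ≤ |η (φ i + i₀)| * ‖uu‖ := mul_le_mul_of_nonneg_right (le_abs_self _) (norm_nonneg _)
        _ ≤ |η (φ i + i₀)| * 2 := mul_le_mul_of_nonneg_left hu2 (abs_nonneg _)
    have e4 : ‖uu - bb‖ ≤ t i := hub
    have e5 : ‖bb - x‖ = ‖x - bb‖ := norm_sub_rev _ _
    calc ‖L x - x‖
        = ‖L (x - bb) + L (bb - uu) + (L uu - Lᵢ (φ i + i₀) uu) + (uu - bb) + (bb - x)‖ := by
          rw [hdecomp]
      _ ≤ ‖L (x - bb)‖ + ‖L (bb - uu)‖ + ‖L uu - Lᵢ (φ i + i₀) uu‖ + ‖uu - bb‖ + ‖bb - x‖ := by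
          have i1 := norm_add_le (L (x - bb) + L (bb - uu) + (L uu - Lᵢ (φ i + i₀) uu) + (uu - bb))
            (bb - x)
          have i2 := norm_add_le (L (x - bb) + L (bb - uu) + (L uu - Lᵢ (φ i + i₀) uu)) (uu - bb)
          have i3 := norm_add_le (L (x - bb) + L (bb - uu)) (L uu - Lᵢ (φ i + i₀) uu)
          have i4 := norm_add_le (L (x - bb)) (L (bb - uu))
          linarith
      _ ≤ R i := by rw [hR_def, e5]; linarith
  -- the error terms tend to zero
  have hR : Tendsto R atTop (𝓝 0) := by
    have hφ' : Tendsto (fun i ↦ φ i + i₀) atTop atTop :=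
      (tendsto_add_atTop_nat i₀).comp hφ.tendsto_atTop
    have h1 : Tendsto (fun i ↦ ‖g j - b (φ i) j‖) atTop (𝓝 0) := by
      have := (tendsto_iff_norm_sub_tendsto_zero.1 (hg_lim j))
      simpa only [norm_sub_rev] using this
    have h2 : Tendsto t atTop (𝓝 0) := by
      have hε'' : Tendsto (fun i ↦ 2 * |ε (φ i + i₀)|) atTop (𝓝 0) := by
        have := (hε.comp hφ').abs
        simpa using this.const_mul 2
      have := (Real.continuous_sqrt.tendsto 0).comp hε''
      rw [Real.sqrt_zero] at this
      simpa [ht_def] using this.const_mul 2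
    have h3 : Tendsto (fun i ↦ |η (φ i + i₀)| * 2) atTop (𝓝 0) := by
      have := (hη.comp hφ').abs
      simpa using this.mul_const 2
    have : Tendsto R atTop (𝓝 (‖L‖ * 0 + ‖L‖ * 0 + 0 + 0 + 0)) :=
      ((((h1.const_mul ‖L‖).add (h2.const_mul ‖L‖)).add h3).add h2).add h1
    simpa using this
  have h0 : ‖L (g j) - g j‖ ≤ 0 := le_of_tendsto_of_tendsto' tendsto_const_nhds hR hbound
  exact sub_eq_zero.1 (norm_le_zero_iff.1 h0)

end Limit

end Literature.Analysis.OperatorTheory
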